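import Literature.AlgebraicGeometry.HodgeTheory.BettiTranscendentalPartK3TypeHodgeLevelProducts
import HarnessLib

/-!
# Minimality of the transcendental part: a morphism `Hdgᵐ(V)^⊥ → K` vanishes under Hodge-LEVEL disjointness; hence `HC(Y × Z)` from `HC(Y)`, `HC(Z)`, no morphisms between the top
# odd cohomologies, and `h^{μ+k, μ−k}(Y) · h^{ν+k, ν−k}(Z) = 0` for every level `k ≥ 1` of the two top even degrees `2μ`, `2ν` — every surface times `Z`, fourfolds times `Z`, two fourfolds
# (Huybrechts K3 Ch. 3 Def. 2.5, Lemma 3.1; Zarhin 1983 §1; Voisin I Def. 7.22, Def. 7.24, Lemma 7.25, Lemma 7.26, §11.3.3 Lemma 11.41, p. 287, Thm. 11.30; Green–Griffiths–Kerr Ch. V p. 154; Voisin II Prop. 9.20)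

Family `hodge`, lane `lit-hodgefound` (Track 2 foundations library; Layers A1/A2/A4), layer `Literature/AlgebraicGeometry/HodgeTheory`.  THEOREMS ONLY (no definition, no named fact,
no instance, no notation; D-0026 net debt `0`).  Prover seat `lit-hodgefound-p21` (generation 40, row g40-#5), sequel of g40-#2 (`BettiTranscendentalPartsHomCountsProductCriteria`: the
all-dimensions criterion `HC(Y × Z)` ⟸ `HC(Y)`, `HC(Z)`, no morphisms between the top odd cohomologies, none `T^{2μ}(Y) → T^{2ν}(Z)(ν − μ)` between the top transcendental parts) and of
g40-#4 (`BettiTranscendentalPartK3TypeHodgeLevelProducts`: for `h^{2,0}(X) = 1`, SCHUR gives `Hom_HS(T(X), K) = 0` whenever `K^{2,0} = 0`).  Here the hypothesis `h^{2,0} = 1` is REMOVED: the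
vanishing follows, in every even weight and for every polarised Hodge structure, from the MINIMALITY of the transcendental part.

THE MATHEMATICS.  Let `(V, ψ)` be a polarised `ℚ`-Hodge structure of even weight `n = 2m`, `V₀ = Hdgᵐ(V)` its Hodge vectors and `T = V₀^⊥` its transcendental part — the SMALLEST sub-Hodge
structure whose complexification contains `F^{m+1} = ⊕_{p > m} V^{p, n−p}` (Huybrechts Def. 2.5, Zarhin §1; the tree's `Polarization.orthogonal_hodgeClasses_le_of_forall_piece_le`).  Let `K` be
a `ℚ`-Hodge structure of weight `n` and `f : T → K` a morphism.  Its kernel `N = ker f ⊆ T` is a sub-Hodge structure of `T` (Voisin Lemma 7.25), hence of `V` (a sub-Hodge structure of a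
sub-Hodge structure; Def. 7.24).  Suppose that **for every `p > m` either `V^{p,n−p} = 0` or `K^{p,n−p} = 0`** (Hodge-LEVEL disjointness above the middle).  Then `V^{p,n−p} ⊆ N_ℂ` for every
`p > m`: such a piece lies in `T_ℂ`, it is the piece `T^{p,n−p}` of the induced structure, and `f_ℂ(T^{p,n−p}) ⊆ K^{p,n−p} = 0` (morphisms have bidegree `(0,0)`, Def. 7.22), i.e.
`T^{p,n−p} ⊆ ker f_ℂ = (ker f)_ℂ` (`ℂ/ℚ` flat).  By minimality `T ⊆ N`, i.e. **`f = 0`** (§1).  With a Tate twist: `Hom_HS(T, K(s)) = 0` as soon as `V^{p,n−p} = 0` or `K^{p+s, n−p+s} = 0` for each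
`p > m`.  For smooth projective `Y`, `Z` with top even degrees `2μ`, `2ν` this reads (§2): **`Hom_HS(T^{2μ}(Y), T'(ν − μ)) = 0` for every sub-Hodge structure `T' ⊆ H^{2ν}(Z)` as soon as
`h^{μ+k, μ−k}(Y) · h^{ν+k, ν−k}(Z) = 0` for every level `k ≥ 1`** (levels `k > μ` or `k > ν` are automatic), and g40-#2's criterion gives (§3): **`HC(Y × Z)` ⟸ `HC(Y)`, `HC(Z)`,
`Hom_HS(H^{mₒ}(Y), H^{nₒ}(Z)((nₒ − mₒ)/2)) = 0` and `h^{μ+k, μ−k}(Y) · h^{ν+k, ν−k}(Z) = 0` for all `k ≥ 1`.**  By hard Lefschetz `h^{μ+k,μ−k}(Y) ≥ h^{c+k,c−k}(Y)` for every lower even degree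
`2c`, so the top even degrees carry the strongest Hodge-level condition; unlike the tree's Hodge-DISJOINTNESS criteria (`…_of_forall_hodgeNumber_eq_zero`, `…_of_hodgeNumber_mul_eq_zero`:
purity `Hdg = H` or products of Hodge numbers over ALL degree pairs) only ONE product per level of the two TOP even degrees is asked.  Instances (§4): **every smooth projective surface `S` (any
`p_g`) times `Z`** ⟸ `HC(Z)`, `Hom_HS(H¹(S), H^{nₒ}(Z)(s)) = 0` (void for `q(S) = 0`), `p_g(S) · h^{ν+1,ν−1}(Z) = 0`; `S ×` fourfold ⟸ `q(S) = 0`, `HC(F)`, `p_g(S) · h^{3,1}(F) = 0`; **a fourfold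
times `Z`** ⟸ `HC(F)`, `HC(Z)`, `Hom_HS(H³(F), H^{nₒ}(Z)(s)) = 0`, `h^{3,1}(F) · h^{ν+1,ν−1}(Z) = 0`, `h^{4,0}(F) · h^{ν+2,ν−2}(Z) = 0`; **two fourfolds** ⟸ `HC(F)`, `HC(F')`, `Hom_HS(H³F, H³F') = 0`,
`h^{3,1}(F) h^{3,1}(F') = 0`, `h^{4,0}(F) h^{4,0}(F') = 0` — e.g. `h^{3,1}(F) = 0 ≠ h^{4,0}(F)` against `h^{4,0}(F') = 0 ≠ h^{3,1}(F')`.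

THE PRINTS.  D. Huybrechts (2016) [Huybrechts2016K3] Ch. 3 Def. 2.5 («the transcendental lattice … the minimal primitive sub-Hodge structure `T ⊂ V` with `V^{2,0} ⊂ T_ℂ`»), Lemma 3.1
(`T = NS^⊥`).  Yu. G. Zarhin (1983) [Zarhin1983] §1.  M. Green, P. Griffiths, M. Kerr (2012) [GreenGriffithsKerr2012] Ch. V, Warning p. 154.  C. Voisin (2002) [VoisinHodgeI2002] §7.3.1
Def. 7.22 (morphisms of bidegree `(0,0)`), Def. 7.24 (sub-Hodge structures), Lemma 7.25 (kernels), §7.1.2 Lemma 7.26; §11.3.1 Thm. 11.30; §11.3.3 Thm. 11.38–11.40, Lemma 11.41, p. 287.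
C. Voisin (2003) [VoisinHodgeII2003] §9.2.4 Prop. 9.20.  P. Deligne (1971) [DeligneHodgeII1971] 2.1.13 (Tate twist); (2000) [Deligne2000] §1.  D. Arapura (2006) [Arapura2006] §4 Lemma 4.2.

THE OBJECTS (all the tree's).  `HodgeStructure`, `piece`, `hodgeClasses`, `Polarization`, `form.orthogonal`, `SubHodgeStructure`, `.toHodgeStructure`, `Hom`, `Hom.ker`, `tateTwist`, `cast`,
`SubHodgeStructure.exists_eq_map_subtype` (sub of sub), `SubHodgeStructure.piece_eq_comap`, `Hom.map_piece_le`, `mem_range_baseChange_ker_subtype` (`ker f_ℂ = (ker f)_ℂ`), `baseChange_map`,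
`Polarization.orthogonal_hodgeClasses_le_of_forall_piece_le` (MINIMALITY), `Polarization.piece_le_baseChange_orthogonal_hodgeClasses`; `Hⁱ(X) = BettiUniverse.hodge hHD hX i`, `hodgeNumber`,
`BettiUniverse.piece_hodge_eq_bot_of_lt_left`, `BettiUniverse.piece_hodge_eq_bot_iff_hodgeNumber_eq_zero`, g40-#2's `BettiUniverse.hodgeConjectureFor_tensor_of_subsingleton_hom_odd_of_subsingleton_hom_transcendental`,
`BettiUniverse.subsingleton_hom_hodge_of_finrank_eq_zero`, `subsingleton_hom_twistCast_zero_right_iff`, `hodgeConjectureFor_of_dim_le_three_holds`, `hodgeConjectureFor_tensor_comm_mp`, `IsSmoothProjective.tensor_holds`.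

WHAT IS PROVED.
* §1 **`Polarization.hom_eq_zero_of_eq_orthogonal_hodgeClasses_of_forall_piece_eq_bot`** (every morphism `Hdgᵐ(V)^⊥ → K` is `0` when `V^{p,n−p} = 0 ∨ K^{p,n−p} = 0` for all `p > m`),
  `Polarization.subsingleton_hom_of_eq_orthogonal_hodgeClasses_of_forall_piece_eq_bot`, **`Polarization.subsingleton_hom_twist_of_eq_orthogonal_hodgeClasses_of_forall_piece_eq_bot`** (target `K(s)`).
* §2 **`BettiUniverse.subsingleton_hom_transcendentalPart_twist_of_forall_hodgeNumber_mul_eq_zero`** (`Hom_HS(T^{2μ}(Y), T'(ν−μ)) = 0` for every `T' ⊆ H^{2ν}(Z)` from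
  `h^{μ+k,μ−k}(Y) · h^{ν+k,ν−k}(Z) = 0`, `1 ≤ k ≤ min(μ, ν)`).
* §3 **`BettiUniverse.hodgeConjectureFor_tensor_of_subsingleton_hom_odd_of_forall_hodgeNumber_mul_eq_zero`** (the criterion above, all dimensions).
* §4 **`BettiUniverse.hodgeConjectureFor_surface_tensor_of_subsingleton_hom_one_of_pg_mul_hodgeNumber_eq_zero`** (every surface), **`…surface_tensor_of_q_zero_of_pg_mul_hodgeNumber_eq_zero`**,
  `…surface_tensor_fourfold_of_q_zero_of_pg_mul_h31_eq_zero`, `…fourfold_tensor_surface_of_q_zero_of_pg_mul_h31_eq_zero`, **`…fourfold_tensor_of_subsingleton_hom_three_of_hodgeNumber_mul_eq_zero`**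
  (fourfold × `Z`), **`…tensor_fourfolds_of_subsingleton_hom_three_of_hodgeNumber_mul_eq_zero`** (two fourfolds).
* §5 (rider) ONE FACTOR WITHOUT TOP ODD COHOMOLOGY — a purely NUMERICAL criterion: **`BettiUniverse.hodgeConjectureFor_tensor_of_finrank_top_odd_eq_zero_left_of_forall_hodgeNumber_mul_eq_zero`**
  (`b_{mₒ}(Y) = 0`: `HC(Y × Z)` ⟸ `HC(Y)`, `HC(Z)`, `h^{μ+k,μ−k}(Y) · h^{ν+k,ν−k}(Z) = 0`), `…_right_…` (`b_{nₒ}(Z) = 0`), **`IsSmoothHypersurface.hodgeConjectureFor_tensor_of_even_dim_of_forall_hodgeNumber_mul_eq_zero`**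
  (an even-dimensional hypersurface times `Z`), **`IsSmoothHypersurface.hodgeConjectureFor_cubicFourfold_tensor_of_hodgeNumber_eq_zero`** (a cubic fourfold times ANY `Z` with `HC(Z)`, `h^{ν+1,ν−1}(Z) = 0`,
  `h^{4,0}(X) · h^{ν+2,ν−2}(Z) = 0`), `…cubicFourfold_tensor_fourfold_of_h31_eq_zero`, `BettiUniverse.hodgeConjectureFor_fourfold_tensor_of_finrank_three_eq_zero_of_hodgeNumber_mul_eq_zero` (`b₃(F) = 0`),
  `BettiUniverse.hodgeConjectureFor_tensor_fourfolds_of_finrank_three_eq_zero_of_hodgeNumber_mul_eq_zero`. [cite: VoisinHodgeII2003, §1.2.3 Cor. 1.24–1.25] [cite: Zucker1977, (3.2) Theorem, p. 206]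

## References
* [Huybrechts2016K3] D. Huybrechts, *Lectures on K3 Surfaces* (2016) — Ch. 3 Def. 2.5, Lemma 3.1.
* [Zarhin1983] Yu. G. Zarhin, *Hodge groups of K3 surfaces*, J. reine angew. Math. 341 (1983) — §1.
* [GreenGriffithsKerr2012] M. Green, P. Griffiths, M. Kerr, *Mumford–Tate Groups and Domains* (2012) — Ch. V, p. 154.
* [VoisinHodgeI2002] C. Voisin, *Hodge Theory and Complex Algebraic Geometry I* (2002) — §7.3.1 Def. 7.22, Def. 7.24, Lemma 7.25; §7.1.2 Lemma 7.26; §11.3.1 Thm. 11.30; §11.3.3 Thm. 11.38–11.40,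
  Lemma 11.41, p. 287.
* [VoisinHodgeII2003] C. Voisin, *Hodge Theory and Complex Algebraic Geometry II* (2003) — §9.2.4 Prop. 9.20.
* [DeligneHodgeII1971] P. Deligne, *Théorie de Hodge II* (1971) — 2.1.13.
* [Deligne2000] P. Deligne, *The Hodge conjecture* (Clay, 2000) — §1.
* [Arapura2006] D. Arapura, *Motivation for Hodge cycles*, Adv. Math. 207 (2006) — §4 Lemma 4.2.
* [Zucker1977] S. Zucker, *The Hodge conjecture for cubic fourfolds*, Compositio Math. 34 (1977) — (3.2) Theorem, p. 206.
* [Murre1977] J. P. Murre, *On the Hodge conjecture for unirational fourfolds*, Indag. Math. 39 (1977) — Theorem and Corollary, p. 230.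

## Provenance
Lane `lit-hodgefound` (Hodge path, Track 2), prover seat `lit-hodgefound-p21` (generation 40), self-proposed row g40-#5 (sequel of g40-#2/#4; uses the tree's `Motives/HodgeStructureHodgeVectorBlockTranscendentalPart`
(minimality), `Motives/HodgeStructureK3TranscendentalProofs` (sub of sub), `Motives/HodgeStructureK3TypeProofs` (flatness of `ℂ/ℚ`), `Motives/HodgeStructureWeil` (`Hom.map_piece_le`), `Motives/HodgeStructureSemisimple` (`baseChange_map`)).
-/

noncomputable section

open scoped TensorProduct
open CategoryTheory MonoidalCategory Module Finset
open Literature.AlgebraicTopology.SingularHomology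
open Literature.Geometry.Kaehler

/-! ### §1 Minimality: a morphism out of the transcendental part vanishes under Hodge-level disjointness (every even weight) -/

namespace Literature.AlgebraicGeometry.Motives.HodgeStructure

variable {V : Type*} [AddCommGroup V] [Module ℚ V] [Module.Finite ℚ V] {n : ℤ} {H : HodgeStructure V n}
variable {W : Type*} [AddCommGroup W] [Module ℚ W]

/-- **Every morphism of Hodge structures out of the transcendental part `T = Hdgᵐ(V)^⊥` of a polarised Hodge structure of weight `n = 2m` vanishes as soon as, for each `p > m`, `V^{p,n−p} = 0`
or the target has `K^{p,n−p} = 0`**: the kernel, pushed into `V`, is a sub-Hodge structure whose complexification contains every `V^{p,n−p}`, `p > m` (`f_ℂ` maps `T^{p,n−p} = V^{p,n−p}`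
into `K^{p,n−p} = 0`, and `ker f_ℂ = (ker f)_ℂ`), so it contains `T` by the MINIMALITY of the transcendental part. [cite: Huybrechts2016K3, Ch. 3 Def. 2.5 and Lemma 3.1] [cite: Zarhin1983, §1]
[cite: VoisinHodgeI2002, §7.3.1 Def. 7.22, Def. 7.24 and Lemma 7.25] [cite: GreenGriffithsKerr2012, Ch. V Warning p. 154] -/
theorem Polarization.hom_eq_zero_of_eq_orthogonal_hodgeClasses_of_forall_piece_eq_bot (ψ : Polarization H) {m : ℤ} (hm : m + m = n) {T : SubHodgeStructure H}
    (hT : T.toSubmodule = ψ.form.orthogonal (H.hodgeClasses m)) {K : HodgeStructure W n} (hK : ∀ p : ℤ, m < p → H.piece p (n - p) = ⊥ ∨ K.piece p (n - p) = ⊥)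
    (f : Hom T.toHodgeStructure K) : f = 0 := by
  -- the kernel of `f`, a sub-Hodge structure of `T`, pushed into `V`
  obtain ⟨N, hN⟩ := T.exists_eq_map_subtype f.ker
  -- minimality: `T ⊆ N`
  have hle : T.toSubmodule ≤ N.toSubmodule := by
    rw [hT]
    refine ψ.orthogonal_hodgeClasses_le_of_forall_piece_le hm N fun p hp x hx ↦ ?_
    rcases hK p hp with h0 | h0
    · rw [h0, Submodule.mem_bot] at hx
      rw [hx]
      exact zero_mem _
    · have hxT : x ∈ T.toSubmodule.baseChange ℂ := by
        rw [hT]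
        exact ψ.piece_le_baseChange_orthogonal_hodgeClasses hm hp.ne' _ hx
      rw [SubHodgeStructure.baseChange_eq_range] at hxT
      obtain ⟨t, rfl⟩ := hxT
      have ht : t ∈ T.toHodgeStructure.piece p (n - p) := by
        rw [SubHodgeStructure.piece_eq_comap]
        exact hx
      have hft : f.toLinearMap.baseChange ℂ t = 0 := by
        have h := f.map_piece_le p (n - p) ⟨t, ht, rfl⟩
        rwa [h0, Submodule.mem_bot] at h
      have htk : t ∈ f.ker.toSubmodule.baseChange ℂ := by
        rw [SubHodgeStructure.baseChange_eq_range]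
        exact mem_range_baseChange_ker_subtype hft
      rw [hN, baseChange_map]
      exact ⟨t, htk, rfl⟩
  apply Hom.ext
  refine LinearMap.ext fun v ↦ ?_
  have hv : (v : V) ∈ N.toSubmodule := hle v.2
  rw [hN] at hv
  obtain ⟨w, hw, hwv⟩ := hv
  obtain rfl : w = v := Subtype.ext hwv
  rw [Hom.zero_toLinearMap, LinearMap.zero_apply]
  exact hw

/-- **`Hom_HS(Hdgᵐ(V)^⊥, K) = 0` under Hodge-level disjointness above the middle** (`V^{p,n−p} = 0 ∨ K^{p,n−p} = 0` for all `p > m`). [cite: Huybrechts2016K3, Ch. 3 Def. 2.5 and Lemma 3.1]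
[cite: Zarhin1983, §1] [cite: VoisinHodgeI2002, §7.3.1 Def. 7.22 and Lemma 7.25] -/
theorem Polarization.subsingleton_hom_of_eq_orthogonal_hodgeClasses_of_forall_piece_eq_bot (ψ : Polarization H) {m : ℤ} (hm : m + m = n) {T : SubHodgeStructure H}
    (hT : T.toSubmodule = ψ.form.orthogonal (H.hodgeClasses m)) {K : HodgeStructure W n} (hK : ∀ p : ℤ, m < p → H.piece p (n - p) = ⊥ ∨ K.piece p (n - p) = ⊥) :
    Subsingleton (Hom T.toHodgeStructure K) :=
  subsingleton_of_forall_eq 0 fun f ↦ ψ.hom_eq_zero_of_eq_orthogonal_hodgeClasses_of_forall_piece_eq_bot hm hT hK f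

/-- **`Hom_HS(Hdgᵐ(V)^⊥, K(s)) = 0` for a Hodge structure `K` of weight `n + 2s` with `V^{p,n−p} = 0 ∨ K^{p+s, n−p+s} = 0` for all `p > m`** (the pieces of the twist: `K(s)^{p,q} = K^{p+s,q+s}`).
[cite: Huybrechts2016K3, Ch. 3 Def. 2.5 and Lemma 3.1] [cite: Zarhin1983, §1] [cite: DeligneHodgeII1971, 2.1.13] -/
theorem Polarization.subsingleton_hom_twist_of_eq_orthogonal_hodgeClasses_of_forall_piece_eq_bot (ψ : Polarization H) {m : ℤ} (hm : m + m = n) {T : SubHodgeStructure H}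
    (hT : T.toSubmodule = ψ.form.orthogonal (H.hodgeClasses m)) {w : ℤ} {K : HodgeStructure W w} {s : ℤ} (hs : w - 2 * s = n)
    (hK : ∀ p : ℤ, m < p → H.piece p (n - p) = ⊥ ∨ K.piece (p + s) (n - p + s) = ⊥) : Subsingleton (Hom T.toHodgeStructure ((K.tateTwist s).cast hs)) :=
  ψ.subsingleton_hom_of_eq_orthogonal_hodgeClasses_of_forall_piece_eq_bot hm hT fun p hp ↦ (hK p hp).imp id fun h ↦ by rw [cast_piece, piece_tateTwist]; exact h

end Literature.AlgebraicGeometry.Motives.HodgeStructure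

namespace Literature.AlgebraicGeometry.HodgeTheory

open Literature.AlgebraicGeometry.Motives
open Literature.AlgebraicGeometry.Motives.HodgeStructure

variable {m n d : ℕ} {Y Z S F F' : SchemeOver ℂ}

/-! ### §2 `Hom_HS(T^{2μ}(Y), T'(ν − μ)) = 0` from `h^{μ+k,μ−k}(Y) · h^{ν+k,ν−k}(Z) = 0`, `k ≥ 1` -/

section Carriers

/-- **`Hom_HS(T^{2μ}(Y), T'(ν − μ)) = 0` for the transcendental part `T^{2μ}(Y) = Hdg^μ(H^{2μ}Y)^⊥` and EVERY sub-Hodge structure `T' ⊆ H^{2ν}(Z)`, as soon as `h^{μ+k, μ−k}(Y) · h^{ν+k, ν−k}(Z) = 0`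
for every level `1 ≤ k ≤ min(μ, ν)`** (levels above `μ` or `ν` vanish by themselves; minimality of the transcendental part, §1). [cite: Huybrechts2016K3, Ch. 3 Def. 2.5 and Lemma 3.1] [cite: Zarhin1983, §1]
[cite: VoisinHodgeI2002, §7.3.1 Def. 7.22, Def. 7.24, Lemma 7.25 and §7.1.1] [cite: DeligneHodgeII1971, 2.1.13] -/
theorem BettiUniverse.subsingleton_hom_transcendentalPart_twist_of_forall_hodgeNumber_mul_eq_zero (hHD : exists_isReal_hodgeModel) (hY : IsSmoothProjective m Y) (hZ : IsSmoothProjective n Z)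
    {μ ν : ℕ} (ψY : Polarization (BettiUniverse.hodge hHD hY (2 * μ))) {TY : SubHodgeStructure (BettiUniverse.hodge hHD hY (2 * μ))}
    (hTY : TY.toSubmodule = ψY.form.orthogonal ((BettiUniverse.hodge hHD hY (2 * μ)).hodgeClasses μ)) (TZ : SubHodgeStructure (BettiUniverse.hodge hHD hZ (2 * ν))) {s' : ℤ}
    (hs' : ((2 * ν : ℕ) : ℤ) - 2 * s' = ((2 * μ : ℕ) : ℤ))
    (h : ∀ k : ℕ, 1 ≤ k → k ≤ μ → k ≤ ν →
      (BettiUniverse.hodge hHD hY (2 * μ)).hodgeNumber ((μ : ℤ) + k) ((μ : ℤ) - k) * (BettiUniverse.hodge hHD hZ (2 * ν)).hodgeNumber ((ν : ℤ) + k) ((ν : ℤ) - k) = 0) :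
    Subsingleton (Hom TY.toHodgeStructure ((TZ.toHodgeStructure.tateTwist s').cast hs')) := by
  haveI := BettiUniverse.finite hY (2 * μ)
  haveI := BettiUniverse.finite hZ (2 * ν)
  have hs₀ : s' = (ν : ℤ) - μ := by push_cast at hs'; omega
  refine ψY.subsingleton_hom_twist_of_eq_orthogonal_hodgeClasses_of_forall_piece_eq_bot (show (μ : ℤ) + μ = ((2 * μ : ℕ) : ℤ) by push_cast; ring) hTY hs' fun p hp ↦ ?_
  by_cases hpt : ((2 * μ : ℕ) : ℤ) < p
  · exact Or.inl (BettiUniverse.piece_hodge_eq_bot_of_lt_left hHD hY (2 * μ) _ hpt)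
  obtain ⟨k, hk⟩ : ∃ k : ℕ, (k : ℤ) = p - μ := ⟨(p - μ).toNat, Int.toNat_of_nonneg (by omega)⟩
  have hk1 : 1 ≤ k := by omega
  have hkμ : k ≤ μ := by push_cast at hpt; omega
  by_cases hkν : ν < k
  · -- level `k > ν`: the piece `H^{2ν}(Z)^{ν+k, ν−k}` vanishes (`ν + k > 2ν`)
    refine Or.inr (TZ.piece_eq_bot_of_piece_eq_bot (BettiUniverse.piece_hodge_eq_bot_of_lt_left hHD hZ (2 * ν) _ ?_))
    push_cast
    omega
  rcases mul_eq_zero.1 (h k hk1 hkμ (not_lt.1 hkν)) with h0 | h0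
  · left
    rw [← BettiUniverse.piece_hodge_eq_bot_iff_hodgeNumber_eq_zero] at h0
    have e1 : (μ : ℤ) + k = p := by omega
    have e2 : (μ : ℤ) - k = ((2 * μ : ℕ) : ℤ) - p := by push_cast; omega
    rwa [e1, e2] at h0
  · right
    rw [← BettiUniverse.piece_hodge_eq_bot_iff_hodgeNumber_eq_zero] at h0
    have e1 : (ν : ℤ) + k = p + s' := by omega
    have e2 : (ν : ℤ) - k = ((2 * μ : ℕ) : ℤ) - p + s' := by push_cast; omega
    rw [e1, e2] at h0
    exact TZ.piece_eq_bot_of_piece_eq_bot h0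

end Carriers

/-! ### §3 `HC(Y × Z)` from `HC(Y)`, `HC(Z)`, no top odd morphisms, and Hodge-level disjointness of the top even degrees -/

section Criterion

/-- **`HC(Y × Z)` ⟸ `HC(Y)`, `HC(Z)`, `Hom_HS(H^{mₒ}(Y), H^{nₒ}(Z)(s)) = 0` (`nₒ − 2s = mₒ`, top odd degrees) and `h^{μ+k, μ−k}(Y) · h^{ν+k, ν−k}(Z) = 0` for every level `1 ≤ k ≤ min(μ, ν)`** (`2μ ≤ dim Y ≤ 2μ + 1`,
`2ν ≤ dim Z ≤ 2ν + 1` the top even degrees): g40-#2's criterion with its even condition `Hom_HS(T^{2μ}(Y), T^{2ν}(Z)(ν − μ)) = 0` discharged by the minimality of the transcendental part (§2).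
[cite: Huybrechts2016K3, Ch. 3 Def. 2.5 and Lemma 3.1] [cite: Zarhin1983, §1] [cite: VoisinHodgeI2002, §7.1.2 Lemma 7.26, §11.3.1 Thm. 11.30, §11.3.3 Thm. 11.38–11.40, Lemma 11.41, p. 287]
[cite: VoisinHodgeII2003, §9.2.4 Prop. 9.20] [cite: Deligne2000, §1] -/
theorem BettiUniverse.hodgeConjectureFor_tensor_of_subsingleton_hom_odd_of_forall_hodgeNumber_mul_eq_zero (hHD : exists_isReal_hodgeModel) (hY : IsSmoothProjective m Y) (hZ : IsSmoothProjective n Z)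
    (hYZ : IsSmoothProjective d (Y ⊗ Z)) (hHCY : HodgeConjectureFor m Y) (hHCZ : HodgeConjectureFor n Z) {mₒ nₒ : ℕ} (hmₒ : Odd mₒ) (hmₒm : mₒ ≤ m) (hmmₒ : m ≤ mₒ + 1) (hnₒ : Odd nₒ)
    (hnₒn : nₒ ≤ n) (hnnₒ : n ≤ nₒ + 1) {s : ℤ} (hs : (nₒ : ℤ) - 2 * s = (mₒ : ℤ))
    (hodd : Subsingleton (Hom (BettiUniverse.hodge hHD hY mₒ) (((BettiUniverse.hodge hHD hZ nₒ).tateTwist s).cast hs))) {μ ν : ℕ} (hμ : 2 * μ ≤ m) (hmμ : m ≤ 2 * μ + 1) (hν : 2 * ν ≤ n)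
    (hnν : n ≤ 2 * ν + 1)
    (hlevel : ∀ k : ℕ, 1 ≤ k → k ≤ μ → k ≤ ν →
      (BettiUniverse.hodge hHD hY (2 * μ)).hodgeNumber ((μ : ℤ) + k) ((μ : ℤ) - k) * (BettiUniverse.hodge hHD hZ (2 * ν)).hodgeNumber ((ν : ℤ) + k) ((ν : ℤ) - k) = 0) :
    HodgeConjectureFor d (Y ⊗ Z) := by
  haveI := BettiUniverse.finite hY (2 * μ)
  haveI := BettiUniverse.finite hZ (2 * ν)
  obtain ⟨ψY⟩ := BettiUniverse.hodge_isPolarizable hHD hY (2 * μ)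
  obtain ⟨ψZ⟩ := BettiUniverse.hodge_isPolarizable hHD hZ (2 * ν)
  obtain ⟨TY, hTY⟩ := ψY.exists_subHodgeStructure_eq_orthogonal_hodgeClasses (show (μ : ℤ) + μ = ((2 * μ : ℕ) : ℤ) by push_cast; ring)
  obtain ⟨TZ, hTZ⟩ := ψZ.exists_subHodgeStructure_eq_orthogonal_hodgeClasses (show (ν : ℤ) + ν = ((2 * ν : ℕ) : ℤ) by push_cast; ring)
  have hs' : ((2 * ν : ℕ) : ℤ) - 2 * ((ν : ℤ) - μ) = ((2 * μ : ℕ) : ℤ) := by push_cast; ring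
  exact BettiUniverse.hodgeConjectureFor_tensor_of_subsingleton_hom_odd_of_subsingleton_hom_transcendental hHD hY hZ hYZ hHCY hHCZ hmₒ hmₒm hmmₒ hnₒ hnₒn hnnₒ hs hodd hμ hmμ hν hnν hs' ψY ψZ
    hTY hTZ (BettiUniverse.subsingleton_hom_transcendentalPart_twist_of_forall_hodgeNumber_mul_eq_zero hHD hY hZ ψY hTY TZ hs' hlevel)

end Criterion

/-! ### §4 Instances: every surface times `Z`; a fourfold times `Z`; two fourfolds -/

section Instances

/-- **EVERY SURFACE (any `p_g`): `HC(S × Z)` ⟸ `HC(Z)`, `Hom_HS(H¹(S), H^{nₒ}(Z)(s)) = 0` and `p_g(S) · h^{ν+1, ν−1}(Z) = 0`** (`nₒ` the top odd, `2ν` the top even degree of `Z`, `nₒ − 2s = 1`; `HC(S)` by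
Lefschetz).  For `p_g(S) = 0` this is the tree's `…_of_pg_zero_of_subsingleton_hom`; for `p_g(S) ≠ 0` it asks ONE Hodge number of `Z`. [cite: Huybrechts2016K3, Ch. 3 Def. 2.5 and Lemma 3.1]
[cite: VoisinHodgeI2002, §7.1.2 Lemma 7.26, §11.3.1 Thm. 11.30, §11.3.3 Lemma 11.41, p. 287] [cite: VoisinHodgeII2003, §9.2.4 Prop. 9.20] [cite: Deligne2000, §1] -/
theorem BettiUniverse.hodgeConjectureFor_surface_tensor_of_subsingleton_hom_one_of_pg_mul_hodgeNumber_eq_zero (hHD : exists_isReal_hodgeModel) (hS : IsSmoothProjective 2 S)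
    (hZ : IsSmoothProjective n Z) (hSZ : IsSmoothProjective d (S ⊗ Z)) (hHCZ : HodgeConjectureFor n Z) {nₒ : ℕ} (hnₒ : Odd nₒ) (hnₒn : nₒ ≤ n) (hnnₒ : n ≤ nₒ + 1) {s : ℤ}
    (hs : (nₒ : ℤ) - 2 * s = ((1 : ℕ) : ℤ)) (hodd : Subsingleton (Hom (BettiUniverse.hodge hHD hS 1) (((BettiUniverse.hodge hHD hZ nₒ).tateTwist s).cast hs))) {ν : ℕ} (hν : 2 * ν ≤ n)
    (hnν : n ≤ 2 * ν + 1) (hlevel : (BettiUniverse.hodge hHD hS 2).hodgeNumber 2 0 * (BettiUniverse.hodge hHD hZ (2 * ν)).hodgeNumber ((ν : ℤ) + 1) ((ν : ℤ) - 1) = 0) :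
    HodgeConjectureFor d (S ⊗ Z) :=
  BettiUniverse.hodgeConjectureFor_tensor_of_subsingleton_hom_odd_of_forall_hodgeNumber_mul_eq_zero hHD hS hZ hSZ (hodgeConjectureFor_of_dim_le_three_holds (by norm_num) hS) hHCZ (mₒ := 1)
    ⟨0, rfl⟩ (by norm_num) (by norm_num) hnₒ hnₒn hnnₒ hs hodd (μ := 1) (by norm_num) (by norm_num) hν hnν fun k hk1 hkμ _ ↦ by
      obtain rfl : k = 1 := le_antisymm hkμ hk1
      rw [show ((1 : ℕ) : ℤ) + ((1 : ℕ) : ℤ) = 2 by norm_num, show ((1 : ℕ) : ℤ) - ((1 : ℕ) : ℤ) = 0 by norm_num, show (ν : ℤ) + ((1 : ℕ) : ℤ) = ν + 1 by norm_num,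
        show (ν : ℤ) - ((1 : ℕ) : ℤ) = ν - 1 by norm_num]
      exact hlevel

/-- **EVERY SURFACE WITH `q(S) = 0` (any `p_g`): `HC(S × Z)` ⟸ `HC(Z)` and `p_g(S) · h^{ν+1, ν−1}(Z) = 0`** (`dim Z = n ≥ 1`, top even degree `2ν ≤ n ≤ 2ν + 1`; the odd condition is void).
E.g. a K3 surface, or any surface with `p_g > 0`, `q = 0`, times a `Z` with `h^{ν+1,ν−1}(Z) = 0` — the other Hodge numbers of `Z` are free. [cite: Huybrechts2016K3, Ch. 3 Def. 2.5 and Lemma 3.1]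
[cite: VoisinHodgeI2002, §11.3.1 Thm. 11.30, §11.3.3 Lemma 11.41, p. 287] [cite: VoisinHodgeII2003, §9.2.4 Prop. 9.20] [cite: Deligne2000, §1] -/
theorem BettiUniverse.hodgeConjectureFor_surface_tensor_of_q_zero_of_pg_mul_hodgeNumber_eq_zero (hHD : exists_isReal_hodgeModel) (hS : IsSmoothProjective 2 S) (hZ : IsSmoothProjective n Z)
    (hSZ : IsSmoothProjective d (S ⊗ Z)) (hHCZ : HodgeConjectureFor n Z) (hq : Module.finrank ℚ (bettiCohomology S 1) = 0) (hn : 1 ≤ n) {ν : ℕ} (hν : 2 * ν ≤ n) (hnν : n ≤ 2 * ν + 1)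
    (hlevel : (BettiUniverse.hodge hHD hS 2).hodgeNumber 2 0 * (BettiUniverse.hodge hHD hZ (2 * ν)).hodgeNumber ((ν : ℤ) + 1) ((ν : ℤ) - 1) = 0) : HodgeConjectureFor d (S ⊗ Z) := by
  -- the top odd degree `nₒ = 2k + 1` of `Z`
  obtain ⟨k, hk⟩ : ∃ k : ℕ, 2 * k + 1 ≤ n ∧ n ≤ 2 * k + 2 := by
    rcases Nat.even_or_odd n with ⟨l, hl⟩ | ⟨l, hl⟩
    · exact ⟨l - 1, by omega, by omega⟩
    · exact ⟨l, by omega, by omega⟩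
  exact BettiUniverse.hodgeConjectureFor_surface_tensor_of_subsingleton_hom_one_of_pg_mul_hodgeNumber_eq_zero hHD hS hZ hSZ hHCZ (nₒ := 2 * k + 1) ⟨k, rfl⟩ hk.1 hk.2 (s := k)
    (by push_cast; ring) (BettiUniverse.subsingleton_hom_hodge_of_finrank_eq_zero hHD hS hq _) hν hnν hlevel

/-- **A surface with `q(S) = 0` times a fourfold: `HC(S × F)` ⟸ `HC(F)` and `p_g(S) · h^{3,1}(F) = 0`** (`h^{4,0}(F)` free). [cite: Huybrechts2016K3, Ch. 3 Def. 2.5 and Lemma 3.1]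
[cite: VoisinHodgeI2002, §11.3.3 Lemma 11.41, p. 287 and §11.3.1 Thm. 11.30] [cite: VoisinHodgeII2003, §9.2.4 Prop. 9.20] -/
theorem BettiUniverse.hodgeConjectureFor_surface_tensor_fourfold_of_q_zero_of_pg_mul_h31_eq_zero (hHD : exists_isReal_hodgeModel) (hS : IsSmoothProjective 2 S) (hF : IsSmoothProjective 4 F)
    (hSF : IsSmoothProjective d (S ⊗ F)) (hHCF : HodgeConjectureFor 4 F) (hq : Module.finrank ℚ (bettiCohomology S 1) = 0)
    (h : (BettiUniverse.hodge hHD hS 2).hodgeNumber 2 0 * (BettiUniverse.hodge hHD hF 4).hodgeNumber 3 1 = 0) : HodgeConjectureFor d (S ⊗ F) :=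
  BettiUniverse.hodgeConjectureFor_surface_tensor_of_q_zero_of_pg_mul_hodgeNumber_eq_zero hHD hS hF hSF hHCF hq (by norm_num) (ν := 2) (by norm_num) (by norm_num)
    (by rw [show ((2 : ℕ) : ℤ) + 1 = 3 by norm_num, show ((2 : ℕ) : ℤ) - 1 = 1 by norm_num]; exact h)

/-- The swapped product: **`HC(F × S)` ⟸ `HC(F)`, `q(S) = 0`, `p_g(S) · h^{3,1}(F) = 0`.** [cite: Arapura2006, §4 Lemma 4.2] [cite: Huybrechts2016K3, Ch. 3 Def. 2.5 and Lemma 3.1]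
[cite: VoisinHodgeI2002, §11.3.3 Lemma 11.41, p. 287] -/
theorem BettiUniverse.hodgeConjectureFor_fourfold_tensor_surface_of_q_zero_of_pg_mul_h31_eq_zero (hHD : exists_isReal_hodgeModel) (hF : IsSmoothProjective 4 F) (hS : IsSmoothProjective 2 S)
    (hHCF : HodgeConjectureFor 4 F) (hq : Module.finrank ℚ (bettiCohomology S 1) = 0) (h : (BettiUniverse.hodge hHD hS 2).hodgeNumber 2 0 * (BettiUniverse.hodge hHD hF 4).hodgeNumber 3 1 = 0) :
    HodgeConjectureFor (4 + 2) (F ⊗ S) :=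
  hodgeConjectureFor_tensor_comm_mp hS hF (BettiUniverse.hodgeConjectureFor_surface_tensor_fourfold_of_q_zero_of_pg_mul_h31_eq_zero hHD hS hF (hS.tensor_holds hF) hHCF hq h)

/-- **A FOURFOLD TIMES `Z`: `HC(F × Z)` ⟸ `HC(F)`, `HC(Z)`, `Hom_HS(H³(F), H^{nₒ}(Z)(s)) = 0` (`nₒ − 2s = 3`), `h^{3,1}(F) · h^{ν+1,ν−1}(Z) = 0` and, when `ν ≥ 2`, `h^{4,0}(F) · h^{ν+2,ν−2}(Z) = 0`** (`2ν` the top even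
degree of `Z`). [cite: Huybrechts2016K3, Ch. 3 Def. 2.5 and Lemma 3.1] [cite: Zarhin1983, §1] [cite: VoisinHodgeI2002, §11.3.1 Thm. 11.30, §11.3.3 Lemma 11.41, p. 287] [cite: VoisinHodgeII2003, §9.2.4 Prop. 9.20]
[cite: Deligne2000, §1] -/
theorem BettiUniverse.hodgeConjectureFor_fourfold_tensor_of_subsingleton_hom_three_of_hodgeNumber_mul_eq_zero (hHD : exists_isReal_hodgeModel) (hF : IsSmoothProjective 4 F)
    (hZ : IsSmoothProjective n Z) (hFZ : IsSmoothProjective d (F ⊗ Z)) (hHCF : HodgeConjectureFor 4 F) (hHCZ : HodgeConjectureFor n Z) {nₒ : ℕ} (hnₒ : Odd nₒ) (hnₒn : nₒ ≤ n)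
    (hnnₒ : n ≤ nₒ + 1) {s : ℤ} (hs : (nₒ : ℤ) - 2 * s = ((3 : ℕ) : ℤ)) (hodd : Subsingleton (Hom (BettiUniverse.hodge hHD hF 3) (((BettiUniverse.hodge hHD hZ nₒ).tateTwist s).cast hs)))
    {ν : ℕ} (hν : 2 * ν ≤ n) (hnν : n ≤ 2 * ν + 1) (h31 : (BettiUniverse.hodge hHD hF 4).hodgeNumber 3 1 * (BettiUniverse.hodge hHD hZ (2 * ν)).hodgeNumber ((ν : ℤ) + 1) ((ν : ℤ) - 1) = 0)
    (h40 : 2 ≤ ν → (BettiUniverse.hodge hHD hF 4).hodgeNumber 4 0 * (BettiUniverse.hodge hHD hZ (2 * ν)).hodgeNumber ((ν : ℤ) + 2) ((ν : ℤ) - 2) = 0) : HodgeConjectureFor d (F ⊗ Z) :=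
  BettiUniverse.hodgeConjectureFor_tensor_of_subsingleton_hom_odd_of_forall_hodgeNumber_mul_eq_zero hHD hF hZ hFZ hHCF hHCZ (mₒ := 3) ⟨1, rfl⟩ (by norm_num) (by norm_num) hnₒ hnₒn hnnₒ hs
    hodd (μ := 2) (by norm_num) (by norm_num) hν hnν fun k hk1 hkμ hkν ↦ by
      rcases (show k = 1 ∨ k = 2 by omega) with rfl | rfl
      · rw [show ((2 : ℕ) : ℤ) + ((1 : ℕ) : ℤ) = 3 by norm_num, show ((2 : ℕ) : ℤ) - ((1 : ℕ) : ℤ) = 1 by norm_num, show (ν : ℤ) + ((1 : ℕ) : ℤ) = ν + 1 by norm_num,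
          show (ν : ℤ) - ((1 : ℕ) : ℤ) = ν - 1 by norm_num]
        exact h31
      · rw [show ((2 : ℕ) : ℤ) + ((2 : ℕ) : ℤ) = 4 by norm_num, show ((2 : ℕ) : ℤ) - ((2 : ℕ) : ℤ) = 0 by norm_num, show (ν : ℤ) + ((2 : ℕ) : ℤ) = ν + 2 by norm_num,
          show (ν : ℤ) - ((2 : ℕ) : ℤ) = ν - 2 by norm_num]
        exact h40 hkν

/-- **TWO FOURFOLDS: `HC(F × F')` ⟸ `HC(F)`, `HC(F')`, `Hom_HS(H³(F), H³(F')) = 0`, `h^{3,1}(F) · h^{3,1}(F') = 0` and `h^{4,0}(F) · h^{4,0}(F') = 0`** — e.g. `h^{3,1}(F) = 0` (and `h^{4,0}(F)` arbitrary)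
against `h^{4,0}(F') = 0` (and `h^{3,1}(F')` arbitrary). [cite: Huybrechts2016K3, Ch. 3 Def. 2.5 and Lemma 3.1] [cite: Zarhin1983, §1] [cite: VoisinHodgeI2002, §11.3.1 Thm. 11.30, §11.3.3 Lemma 11.41, p. 287]
[cite: VoisinHodgeII2003, §9.2.4 Prop. 9.20] [cite: Deligne2000, §1] -/
theorem BettiUniverse.hodgeConjectureFor_tensor_fourfolds_of_subsingleton_hom_three_of_hodgeNumber_mul_eq_zero (hHD : exists_isReal_hodgeModel) (hF : IsSmoothProjective 4 F)
    (hF' : IsSmoothProjective 4 F') (hFF' : IsSmoothProjective d (F ⊗ F')) (hHCF : HodgeConjectureFor 4 F) (hHCF' : HodgeConjectureFor 4 F')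
    (h33 : Subsingleton (Hom (BettiUniverse.hodge hHD hF 3) (BettiUniverse.hodge hHD hF' 3))) (h31 : (BettiUniverse.hodge hHD hF 4).hodgeNumber 3 1 * (BettiUniverse.hodge hHD hF' 4).hodgeNumber 3 1 = 0)
    (h40 : (BettiUniverse.hodge hHD hF 4).hodgeNumber 4 0 * (BettiUniverse.hodge hHD hF' 4).hodgeNumber 4 0 = 0) : HodgeConjectureFor d (F ⊗ F') :=
  BettiUniverse.hodgeConjectureFor_fourfold_tensor_of_subsingleton_hom_three_of_hodgeNumber_mul_eq_zero hHD hF hF' hFF' hHCF hHCF' (nₒ := 3) ⟨1, rfl⟩ (by norm_num) (by norm_num) (s := 0)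
    (by norm_num) ((subsingleton_hom_twistCast_zero_right_iff _ _ _).2 h33) (ν := 2) (by norm_num) (by norm_num)
    (by rw [show ((2 : ℕ) : ℤ) + 1 = 3 by norm_num, show ((2 : ℕ) : ℤ) - 1 = 1 by norm_num]; exact h31)
    fun _ ↦ by rw [show ((2 : ℕ) : ℤ) + 2 = 4 by norm_num, show ((2 : ℕ) : ℤ) - 2 = 0 by norm_num]; exact h40

end Instances

/-! ### §5 (rider) One factor without top odd cohomology: a purely numerical criterion; even-dimensional hypersurfaces and cubic fourfolds times `Z` -/

section NoTopOdd

/-- **`b_{mₒ}(Y) = 0` (no top odd cohomology on the left): `HC(Y × Z)` ⟸ `HC(Y)`, `HC(Z)` and `h^{μ+k, μ−k}(Y) · h^{ν+k, ν−k}(Z) = 0` for `1 ≤ k ≤ min(μ, ν)`** (`dim Z = n ≥ 1`; `2μ`, `2ν` the top even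
degrees) — the odd condition of §3 is void, so the criterion is purely NUMERICAL. [cite: Huybrechts2016K3, Ch. 3 Def. 2.5 and Lemma 3.1] [cite: VoisinHodgeI2002, §11.3.3 Thm. 11.38–11.40, Lemma 11.41, p. 287]
[cite: VoisinHodgeII2003, §9.2.4 Prop. 9.20] [cite: Deligne2000, §1] -/
theorem BettiUniverse.hodgeConjectureFor_tensor_of_finrank_top_odd_eq_zero_left_of_forall_hodgeNumber_mul_eq_zero (hHD : exists_isReal_hodgeModel) (hY : IsSmoothProjective m Y)
    (hZ : IsSmoothProjective n Z) (hYZ : IsSmoothProjective d (Y ⊗ Z)) (hHCY : HodgeConjectureFor m Y) (hHCZ : HodgeConjectureFor n Z) {mₒ : ℕ} (hmₒ : Odd mₒ) (hmₒm : mₒ ≤ m)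
    (hmmₒ : m ≤ mₒ + 1) (hb : Module.finrank ℚ (bettiCohomology Y mₒ) = 0) (hn : 1 ≤ n) {μ ν : ℕ} (hμ : 2 * μ ≤ m) (hmμ : m ≤ 2 * μ + 1) (hν : 2 * ν ≤ n) (hnν : n ≤ 2 * ν + 1)
    (hlevel : ∀ k : ℕ, 1 ≤ k → k ≤ μ → k ≤ ν →
      (BettiUniverse.hodge hHD hY (2 * μ)).hodgeNumber ((μ : ℤ) + k) ((μ : ℤ) - k) * (BettiUniverse.hodge hHD hZ (2 * ν)).hodgeNumber ((ν : ℤ) + k) ((ν : ℤ) - k) = 0) :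
    HodgeConjectureFor d (Y ⊗ Z) := by
  obtain ⟨a, rfl⟩ := hmₒ
  -- the top odd degree `nₒ = 2k + 1` of `Z`
  obtain ⟨k, hk⟩ : ∃ k : ℕ, 2 * k + 1 ≤ n ∧ n ≤ 2 * k + 2 := by
    rcases Nat.even_or_odd n with ⟨l, hl⟩ | ⟨l, hl⟩
    · exact ⟨l - 1, by omega, by omega⟩
    · exact ⟨l, by omega, by omega⟩
  exact BettiUniverse.hodgeConjectureFor_tensor_of_subsingleton_hom_odd_of_forall_hodgeNumber_mul_eq_zero hHD hY hZ hYZ hHCY hHCZ (mₒ := 2 * a + 1) ⟨a, rfl⟩ hmₒm hmmₒ (nₒ := 2 * k + 1)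
    ⟨k, rfl⟩ hk.1 hk.2 (s := (k : ℤ) - a) (by push_cast; ring) (BettiUniverse.subsingleton_hom_hodge_of_finrank_eq_zero hHD hY hb _) hμ hmμ hν hnν hlevel

/-- **`b_{nₒ}(Z) = 0` (no top odd cohomology on the right): `HC(Y × Z)` ⟸ `HC(Y)`, `HC(Z)` and `h^{μ+k, μ−k}(Y) · h^{ν+k, ν−k}(Z) = 0` for `1 ≤ k ≤ min(μ, ν)`** (`dim Y = m ≥ 1`).
[cite: Huybrechts2016K3, Ch. 3 Def. 2.5 and Lemma 3.1] [cite: VoisinHodgeI2002, §11.3.3 Thm. 11.38–11.40, Lemma 11.41, p. 287] [cite: VoisinHodgeII2003, §9.2.4 Prop. 9.20] [cite: Deligne2000, §1] -/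
theorem BettiUniverse.hodgeConjectureFor_tensor_of_finrank_top_odd_eq_zero_right_of_forall_hodgeNumber_mul_eq_zero (hHD : exists_isReal_hodgeModel) (hY : IsSmoothProjective m Y)
    (hZ : IsSmoothProjective n Z) (hYZ : IsSmoothProjective d (Y ⊗ Z)) (hHCY : HodgeConjectureFor m Y) (hHCZ : HodgeConjectureFor n Z) (hm : 1 ≤ m) {nₒ : ℕ} (hnₒ : Odd nₒ) (hnₒn : nₒ ≤ n)
    (hnnₒ : n ≤ nₒ + 1) (hb : Module.finrank ℚ (bettiCohomology Z nₒ) = 0) {μ ν : ℕ} (hμ : 2 * μ ≤ m) (hmμ : m ≤ 2 * μ + 1) (hν : 2 * ν ≤ n) (hnν : n ≤ 2 * ν + 1)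
    (hlevel : ∀ k : ℕ, 1 ≤ k → k ≤ μ → k ≤ ν →
      (BettiUniverse.hodge hHD hY (2 * μ)).hodgeNumber ((μ : ℤ) + k) ((μ : ℤ) - k) * (BettiUniverse.hodge hHD hZ (2 * ν)).hodgeNumber ((ν : ℤ) + k) ((ν : ℤ) - k) = 0) :
    HodgeConjectureFor d (Y ⊗ Z) := by
  obtain ⟨a, rfl⟩ := hnₒ
  -- the top odd degree `mₒ = 2k + 1` of `Y`
  obtain ⟨k, hk⟩ : ∃ k : ℕ, 2 * k + 1 ≤ m ∧ m ≤ 2 * k + 2 := by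
    rcases Nat.even_or_odd m with ⟨l, hl⟩ | ⟨l, hl⟩
    · exact ⟨l - 1, by omega, by omega⟩
    · exact ⟨l, by omega, by omega⟩
  exact BettiUniverse.hodgeConjectureFor_tensor_of_subsingleton_hom_odd_of_forall_hodgeNumber_mul_eq_zero hHD hY hZ hYZ hHCY hHCZ (mₒ := 2 * k + 1) ⟨k, rfl⟩ hk.1 hk.2 (nₒ := 2 * a + 1)
    ⟨a, rfl⟩ hnₒn hnnₒ (s := (a : ℤ) - k) (by push_cast; ring) (BettiUniverse.subsingleton_hom_hodge_tateTwist_of_finrank_eq_zero hHD hZ hb _ _) hμ hmμ hν hnν hlevel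

/-- **A fourfold with `b₃(F) = 0` times `Z`: `HC(F × Z)` ⟸ `HC(F)`, `HC(Z)`, `h^{3,1}(F) · h^{ν+1,ν−1}(Z) = 0` and, when `ν ≥ 2`, `h^{4,0}(F) · h^{ν+2,ν−2}(Z) = 0`** (`dim Z = n ≥ 1`, top even degree `2ν`).
[cite: Huybrechts2016K3, Ch. 3 Def. 2.5 and Lemma 3.1] [cite: VoisinHodgeI2002, §11.3.3 Thm. 11.38–11.40, Lemma 11.41, p. 287] [cite: VoisinHodgeII2003, §9.2.4 Prop. 9.20] [cite: Deligne2000, §1] -/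
theorem BettiUniverse.hodgeConjectureFor_fourfold_tensor_of_finrank_three_eq_zero_of_hodgeNumber_mul_eq_zero (hHD : exists_isReal_hodgeModel) (hF : IsSmoothProjective 4 F)
    (hZ : IsSmoothProjective n Z) (hFZ : IsSmoothProjective d (F ⊗ Z)) (hHCF : HodgeConjectureFor 4 F) (hHCZ : HodgeConjectureFor n Z) (hb : Module.finrank ℚ (bettiCohomology F 3) = 0)
    (hn : 1 ≤ n) {ν : ℕ} (hν : 2 * ν ≤ n) (hnν : n ≤ 2 * ν + 1) (h31 : (BettiUniverse.hodge hHD hF 4).hodgeNumber 3 1 * (BettiUniverse.hodge hHD hZ (2 * ν)).hodgeNumber ((ν : ℤ) + 1) ((ν : ℤ) - 1) = 0)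
    (h40 : 2 ≤ ν → (BettiUniverse.hodge hHD hF 4).hodgeNumber 4 0 * (BettiUniverse.hodge hHD hZ (2 * ν)).hodgeNumber ((ν : ℤ) + 2) ((ν : ℤ) - 2) = 0) : HodgeConjectureFor d (F ⊗ Z) :=
  BettiUniverse.hodgeConjectureFor_tensor_of_finrank_top_odd_eq_zero_left_of_forall_hodgeNumber_mul_eq_zero hHD hF hZ hFZ hHCF hHCZ (mₒ := 3) ⟨1, rfl⟩ (by norm_num) (by norm_num) hb hn
    (μ := 2) (by norm_num) (by norm_num) hν hnν fun k hk1 hkμ hkν ↦ by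
      rcases (show k = 1 ∨ k = 2 by omega) with rfl | rfl
      · rw [show ((2 : ℕ) : ℤ) + ((1 : ℕ) : ℤ) = 3 by norm_num, show ((2 : ℕ) : ℤ) - ((1 : ℕ) : ℤ) = 1 by norm_num, show (ν : ℤ) + ((1 : ℕ) : ℤ) = ν + 1 by norm_num,
          show (ν : ℤ) - ((1 : ℕ) : ℤ) = ν - 1 by norm_num]
        exact h31
      · rw [show ((2 : ℕ) : ℤ) + ((2 : ℕ) : ℤ) = 4 by norm_num, show ((2 : ℕ) : ℤ) - ((2 : ℕ) : ℤ) = 0 by norm_num, show (ν : ℤ) + ((2 : ℕ) : ℤ) = ν + 2 by norm_num,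
          show (ν : ℤ) - ((2 : ℕ) : ℤ) = ν - 2 by norm_num]
        exact h40 hkν

/-- **Two fourfolds, one with `b₃ = 0`: `HC(F × F')` ⟸ `HC(F)`, `HC(F')`, `h^{3,1}(F) · h^{3,1}(F') = 0`, `h^{4,0}(F) · h^{4,0}(F') = 0`** — purely numerical. [cite: Huybrechts2016K3, Ch. 3 Def. 2.5 and Lemma 3.1]
[cite: VoisinHodgeI2002, §11.3.3 Thm. 11.38–11.40, Lemma 11.41, p. 287] [cite: VoisinHodgeII2003, §9.2.4 Prop. 9.20] [cite: Deligne2000, §1] -/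
theorem BettiUniverse.hodgeConjectureFor_tensor_fourfolds_of_finrank_three_eq_zero_of_hodgeNumber_mul_eq_zero (hHD : exists_isReal_hodgeModel) (hF : IsSmoothProjective 4 F)
    (hF' : IsSmoothProjective 4 F') (hFF' : IsSmoothProjective d (F ⊗ F')) (hHCF : HodgeConjectureFor 4 F) (hHCF' : HodgeConjectureFor 4 F') (hb : Module.finrank ℚ (bettiCohomology F 3) = 0)
    (h31 : (BettiUniverse.hodge hHD hF 4).hodgeNumber 3 1 * (BettiUniverse.hodge hHD hF' 4).hodgeNumber 3 1 = 0)
    (h40 : (BettiUniverse.hodge hHD hF 4).hodgeNumber 4 0 * (BettiUniverse.hodge hHD hF' 4).hodgeNumber 4 0 = 0) : HodgeConjectureFor d (F ⊗ F') :=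
  BettiUniverse.hodgeConjectureFor_fourfold_tensor_of_finrank_three_eq_zero_of_hodgeNumber_mul_eq_zero hHD hF hF' hFF' hHCF hHCF' hb (by norm_num) (ν := 2) (by norm_num) (by norm_num)
    (by rw [show ((2 : ℕ) : ℤ) + 1 = 3 by norm_num, show ((2 : ℕ) : ℤ) - 1 = 1 by norm_num]; exact h31)
    fun _ ↦ by rw [show ((2 : ℕ) : ℤ) + 2 = 4 by norm_num, show ((2 : ℕ) : ℤ) - 2 = 0 by norm_num]; exact h40

end NoTopOdd

end Literature.AlgebraicGeometry.HodgeTheory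

namespace Literature.AlgebraicGeometry.Motives.IsSmoothHypersurface

open Literature.AlgebraicGeometry.Motives
open Literature.AlgebraicGeometry.Motives.HodgeStructure
open Literature.AlgebraicGeometry.HodgeTheory

variable {m n e : ℕ} {X Y Z F : SchemeOver ℂ}

/-- **AN EVEN-DIMENSIONAL SMOOTH HYPERSURFACE TIMES ANYTHING, numerically.**  `Y ⊂ ℙ^{2h+1}_ℂ` smooth (`h ≥ 1`) with `HC(Y)`, `Z` smooth projective of dimension `n ≥ 1` with `HC(Z)` and top even degree
`2ν`: **`HC(Y × Z)` ⟸ `h^{h+k, h−k}(Y) · h^{ν+k, ν−k}(Z) = 0` for `1 ≤ k ≤ min(h, ν)`** (`b_{2h−1}(Y) = 0`, Cor. 1.24/1.25, so §5's numerical criterion applies). [cite: VoisinHodgeII2003, §1.2.2 Thm. 1.23, §1.2.3 Cor. 1.24–1.25 and §9.2.4 Prop. 9.20]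
[cite: Huybrechts2016K3, Ch. 3 Def. 2.5 and Lemma 3.1] [cite: VoisinHodgeI2002, §11.3.3 Thm. 11.38–11.40, Lemma 11.41, p. 287] [cite: Deligne2000, §1] -/
theorem hodgeConjectureFor_tensor_of_even_dim_of_forall_hodgeNumber_mul_eq_zero (hY : IsSmoothHypersurface m e Y) (hHD : exists_isReal_hodgeModel) {h : ℕ} (hm : m = 2 * h) (hh : 1 ≤ h)
    (hHC : HodgeConjectureFor m Y) (hZ : IsSmoothProjective n Z) (hHCZ : HodgeConjectureFor n Z) (hn : 1 ≤ n) {ν : ℕ} (hν : 2 * ν ≤ n) (hnν : n ≤ 2 * ν + 1)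
    (hlevel : ∀ k : ℕ, 1 ≤ k → k ≤ h → k ≤ ν →
      (BettiUniverse.hodge hHD hY.1 (2 * h)).hodgeNumber ((h : ℤ) + k) ((h : ℤ) - k) * (BettiUniverse.hodge hHD hZ (2 * ν)).hodgeNumber ((ν : ℤ) + k) ((ν : ℤ) - k) = 0) :
    HodgeConjectureFor (m + n) (Y ⊗ Z) := by
  subst hm
  exact BettiUniverse.hodgeConjectureFor_tensor_of_finrank_top_odd_eq_zero_left_of_forall_hodgeNumber_mul_eq_zero hHD hY.1 hZ (hY.1.tensor_holds hZ) hHC hHCZ (mₒ := 2 * h - 1)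
    ⟨h - 1, by omega⟩ (by omega) (by omega) (hY.finrank_bettiCohomology_eq_zero_of_odd ⟨h - 1, by omega⟩ (by omega)) hn (μ := h) le_rfl (by omega) hν hnν hlevel

/-- **A CUBIC FOURFOLD TIMES ANYTHING, numerically.**  `X ⊂ ℙ⁵_ℂ` a smooth cubic fourfold (`HC(X)`: Zucker, Murre), `Z` smooth projective of dimension `n ≥ 1` with `HC(Z)` and top even degree `2ν`:
**`HC(X × Z)` ⟸ `h^{ν+1, ν−1}(Z) = 0` and, when `ν ≥ 2`, `h^{4,0}(X) · h^{ν+2, ν−2}(Z) = 0`** (e.g. a fourfold with `h^{3,1} = 0`, a sixfold with `h^{4,2} = 0 = h^{5,1}`; `h^{4,0}(X) = 0` in fact, not used).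
[cite: Zucker1977, (3.2) Theorem, p. 206] [cite: Murre1977, Theorem and Corollary, p. 230] [cite: VoisinHodgeII2003, §1.2.3 Cor. 1.24–1.25 and §9.2.4 Prop. 9.20] [cite: Huybrechts2016K3, Ch. 3 Def. 2.5 and Lemma 3.1]
[cite: VoisinHodgeI2002, §11.3.3 Thm. 11.38–11.40, Lemma 11.41, p. 287] [cite: Deligne2000, §1] -/
theorem hodgeConjectureFor_cubicFourfold_tensor_of_hodgeNumber_eq_zero (hX : IsSmoothHypersurface 4 3 X) (hHD : exists_isReal_hodgeModel) (hZ : IsSmoothProjective n Z) (hHCZ : HodgeConjectureFor n Z)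
    (hn : 1 ≤ n) {ν : ℕ} (hν : 2 * ν ≤ n) (hnν : n ≤ 2 * ν + 1) (h1 : (BettiUniverse.hodge hHD hZ (2 * ν)).hodgeNumber ((ν : ℤ) + 1) ((ν : ℤ) - 1) = 0)
    (h2 : 2 ≤ ν → (BettiUniverse.hodge hHD hX.1 4).hodgeNumber 4 0 * (BettiUniverse.hodge hHD hZ (2 * ν)).hodgeNumber ((ν : ℤ) + 2) ((ν : ℤ) - 2) = 0) : HodgeConjectureFor (4 + n) (X ⊗ Z) :=
  hX.hodgeConjectureFor_tensor_of_even_dim_of_forall_hodgeNumber_mul_eq_zero hHD (h := 2) rfl (by norm_num) (hodgeConjectureFor_cubicFourfold_holds hX) hZ hHCZ hn hν hnν fun k hk1 hkμ hkν ↦ by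
    rcases (show k = 1 ∨ k = 2 by omega) with rfl | rfl
    · rw [show ((2 : ℕ) : ℤ) + ((1 : ℕ) : ℤ) = 3 by norm_num, show ((2 : ℕ) : ℤ) - ((1 : ℕ) : ℤ) = 1 by norm_num, show (ν : ℤ) + ((1 : ℕ) : ℤ) = ν + 1 by norm_num,
        show (ν : ℤ) - ((1 : ℕ) : ℤ) = ν - 1 by norm_num, h1, mul_zero]
    · rw [show ((2 : ℕ) : ℤ) + ((2 : ℕ) : ℤ) = 4 by norm_num, show ((2 : ℕ) : ℤ) - ((2 : ℕ) : ℤ) = 0 by norm_num, show (ν : ℤ) + ((2 : ℕ) : ℤ) = ν + 2 by norm_num,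
        show (ν : ℤ) - ((2 : ℕ) : ℤ) = ν - 2 by norm_num]
      exact h2 hkν

/-- **A cubic fourfold times a fourfold with `h^{3,1}(F) = 0`: `HC(X × F)` ⟸ `HC(F)`, `h^{3,1}(F) = 0`, `h^{4,0}(X) · h^{4,0}(F) = 0`.** [cite: Zucker1977, (3.2) Theorem, p. 206] [cite: Murre1977, Theorem and Corollary, p. 230]
[cite: VoisinHodgeII2003, §1.2.3 Cor. 1.24–1.25 and §9.2.4 Prop. 9.20] [cite: Huybrechts2016K3, Ch. 3 Def. 2.5 and Lemma 3.1] [cite: VoisinHodgeI2002, §11.3.3 Lemma 11.41, p. 287] -/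
theorem hodgeConjectureFor_cubicFourfold_tensor_fourfold_of_h31_eq_zero (hX : IsSmoothHypersurface 4 3 X) (hHD : exists_isReal_hodgeModel) (hF : IsSmoothProjective 4 F) (hHCF : HodgeConjectureFor 4 F)
    (h31 : (BettiUniverse.hodge hHD hF 4).hodgeNumber 3 1 = 0) (h40 : (BettiUniverse.hodge hHD hX.1 4).hodgeNumber 4 0 * (BettiUniverse.hodge hHD hF 4).hodgeNumber 4 0 = 0) :
    HodgeConjectureFor (4 + 4) (X ⊗ F) :=
  hX.hodgeConjectureFor_cubicFourfold_tensor_of_hodgeNumber_eq_zero hHD hF hHCF (by norm_num) (ν := 2) (by norm_num) (by norm_num)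
    (by rw [show ((2 : ℕ) : ℤ) + 1 = 3 by norm_num, show ((2 : ℕ) : ℤ) - 1 = 1 by norm_num]; exact h31)
    fun _ ↦ by rw [show ((2 : ℕ) : ℤ) + 2 = 4 by norm_num, show ((2 : ℕ) : ℤ) - 2 = 0 by norm_num]; exact h40

end Literature.AlgebraicGeometry.Motives.IsSmoothHypersurface

end
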